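import Summits.CriticalPhenomena.SAWScalingLimit.Theses.SAWRenewalTightness
import Summits.CriticalPhenomena.SAWScalingLimit.Theorems.SubseqIdentification.Negative.CoincidentEndpointLaw

/-!
# `EventualTight` — negative knowledge: the endpoint limits are load-bearing

Support file for the crux `stmt-CriticalPhenomena-1372`
(`Summit.CriticalPhenomena.SAWScalingLimit.Theses.SAWRenewalTightness.EventualTight`; refuter
`cdisprove`, standing adversary; indexed work file
`Summits/CriticalPhenomena/SAWScalingLimit/Cruxes/EventualTight/Disproof.lean`, §2).

* `eventualTight_false_without_endpointLimits`: the crux with the two endpoint limits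
  `IsEndpointApprox.tendsto_fst/snd` dropped (only `reachable` kept) is FALSE. Loophole: the type
  `DomainSAW Ω δ w w` contains the trivial walk for EVERY site `w`, also outside `Ω_δ`, so between
  coincident endpoints the pushed law is the Dirac mass at the constant class at `δ · w`
  (`map_law_coincident`); with `w = (⌈δ⁻²⌉₊, 0)` its starting point has norm `≥ δ⁻¹`, unbounded as
  `δ → 0⁺` inside every `(0, δ₀]`, while `CurveClass.source` is bounded on compact sets. Hence the
  `∃ δ₀` repair of the refuted all-`δ` statement stmt-0772 is sound only together with the endpoint
  limits. Everything proved, standard axioms. [folklore]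
-/

noncomputable section

open MeasureTheory Filter Topology Set Metric
open Literature.Probability.RandomPlanarGeometry Literature.Probability.RandomPlanarGeometry.SAW
  Literature.Probability.LatticeModels
open scoped ENNReal

namespace Summit.CriticalPhenomena.SAWScalingLimit.Theorems.EventualTight.Negative

open Summit.CriticalPhenomena.SAWScalingLimit.Theorems.SubseqIdentification.Negative (law_self curve_nil)

/-- `‖δ · (⌈t⁻²⌉₊, 0)‖ = δ ⌈t⁻²⌉₊` for `δ ≥ 0`. [folklore] -/
theorem norm_meshPoint_far {δ : ℝ} (hδ : 0 ≤ δ) (t : ℝ) :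
    ‖meshPoint δ ![((⌈t⁻¹ ^ 2⌉₊ : ℕ) : ℤ), 0]‖ = δ * (⌈t⁻¹ ^ 2⌉₊ : ℝ) := by
  have h : meshPoint δ ![((⌈t⁻¹ ^ 2⌉₊ : ℕ) : ℤ), 0] = ((δ * (⌈t⁻¹ ^ 2⌉₊ : ℕ) : ℝ) : ℂ) :=
    Complex.ext (by simp) (by simp)
  rw [h, Complex.norm_real, Real.norm_eq_abs, abs_of_nonneg (by positivity)]

/-- `‖δ · (⌈t⁻²⌉₊, 0)‖ ≥ δ t⁻²`. [folklore] -/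
theorem le_norm_meshPoint_far {δ t : ℝ} (hδ : 0 ≤ δ) :
    δ * t⁻¹ ^ 2 ≤ ‖meshPoint δ ![((⌈t⁻¹ ^ 2⌉₊ : ℕ) : ℤ), 0]‖ := by
  rw [norm_meshPoint_far hδ]
  exact mul_le_mul_of_nonneg_left (Nat.le_ceil _) hδ

/-- `‖δ · (⌈δ⁻²⌉₊, 0)‖ ≥ δ⁻¹`: the far sites escape to infinity as `δ → 0⁺`. [folklore] -/
theorem inv_le_norm_meshPoint_far {δ : ℝ} (hδ : 0 < δ) :
    δ⁻¹ ≤ ‖meshPoint δ ![((⌈δ⁻¹ ^ 2⌉₊ : ℕ) : ℤ), 0]‖ := by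
  refine le_trans (le_of_eq ?_) (le_norm_meshPoint_far (t := δ) hδ.le)
  rw [sq, ← mul_assoc, mul_inv_cancel₀ hδ.ne', one_mul]

/-- The pushed critical SAW law between COINCIDENT endpoints is the Dirac mass at the constant class
at `δ · w` — for every `Ω`, `δ` and every site `w`, also outside `Ω_δ`. [folklore] -/
theorem map_law_coincident (Ω : Set ℂ) (δ : ℝ) {u v w : Site 2} (hu : u = w) (hv : v = w) :
    (law Ω δ u v).map (fun γ => γ.curve) =
      Measure.dirac (CurveClass.mk (Curve.const (meshPoint δ w))) := by
  subst hu hv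
  rw [law_self, Measure.map_dirac' (DomainSAW.measurable_of_top _), curve_nil]

/-- A Dirac law at a class outside the closed set `K` gives `Kᶜ` mass `1`. [folklore] -/
theorem dirac_compl_eq_one {K : Set (CurveClass ℂ)} (hK : IsClosed K) {c : CurveClass ℂ}
    (hc : c ∉ K) : Measure.dirac c Kᶜ = 1 := by
  rw [Measure.dirac_apply' _ hK.measurableSet.compl, Set.indicator_of_mem (Set.mem_compl hc),
    Pi.one_apply]

/-- On a compact set of curve classes the starting points are bounded. [folklore] -/
theorem exists_bound_source_of_isCompact {K : Set (CurveClass ℂ)} (hK : IsCompact K) :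
    ∃ R : ℝ, 0 ≤ R ∧ ∀ c ∈ K, ‖c.source‖ ≤ R := by
  obtain ⟨R, hR⟩ := (isBounded_iff_subset_closedBall 0).1
    (hK.image CurveClass.continuous_source).isBounded
  refine ⟨max R 0, le_max_right _ _, fun c hc => ?_⟩
  have := hR (mem_image_of_mem _ hc)
  rw [mem_closedBall, dist_zero_right] at this
  exact this.trans (le_max_left _ _)

/-- **The endpoint limits are load-bearing for `EventualTight`**: with `tendsto_fst` / `tendsto_snd`
dropped from `IsEndpointApprox` (only `reachable` kept) the statement of the crux is FALSE.
Witness: the unit disc, `a δ = b δ = (⌈δ⁻²⌉₊, 0)` (joined by the trivial walk: `Reachable` is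
reflexive), whose law is the Dirac mass at the constant curve at distance `≥ δ⁻¹` from the origin,
escaping every compact set of curve classes as `δ → 0⁺` inside any `(0, δ₀]`. [folklore] -/
theorem eventualTight_false_without_endpointLimits :
    ¬ (∀ (D : DobrushinDomain) (a b : ℝ → Site 2),
        (∀ᶠ δ in 𝓝[>] (0 : ℝ), (discreteDomainGraph D.carrier δ).Reachable (a δ) (b δ)) →
        ∃ δ₀ : ℝ, 0 < δ₀ ∧ IsTightMeasureSet
          ((fun δ => (law D.carrier δ (a δ) (b δ)).map (fun γ => γ.curve)) '' Set.Ioc 0 δ₀)) := by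
  intro h
  obtain ⟨δ₀, hδ₀, hT⟩ := h DobrushinDomain.unitDisc (fun δ => ![((⌈δ⁻¹ ^ 2⌉₊ : ℕ) : ℤ), 0])
    (fun δ => ![((⌈δ⁻¹ ^ 2⌉₊ : ℕ) : ℤ), 0]) (Eventually.of_forall fun δ => SimpleGraph.Reachable.refl _)
  rw [isTightMeasureSet_iff_exists_isCompact_measure_compl_le] at hT
  obtain ⟨K, hK, hμ⟩ := hT 2⁻¹ (by simp)
  obtain ⟨R, hR0, hR⟩ := exists_bound_source_of_isCompact hK
  -- a mesh in `(0, δ₀]` with `δ⁻¹ > R`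
  set δ : ℝ := min δ₀ (1 / (R + 1)) with hδ_def
  have hδpos : 0 < δ := lt_min hδ₀ (by positivity)
  have hδle : δ ≤ δ₀ := min_le_left _ _
  have hδR : R < δ⁻¹ := by
    have h1 : δ ≤ 1 / (R + 1) := min_le_right _ _
    have h2 : R + 1 ≤ δ⁻¹ := (le_inv_comm₀ (by positivity) hδpos).2 (by simpa [one_div] using h1)
    linarith
  have hle := hμ _ ⟨δ, ⟨hδpos, hδle⟩, rfl⟩
  have hnot : CurveClass.mk (Curve.const (meshPoint δ ![((⌈δ⁻¹ ^ 2⌉₊ : ℕ) : ℤ), 0])) ∉ K :=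
    fun hin => by
      have h1 := hR _ hin
      simp only [CurveClass.source_mk, Curve.source_def, Curve.const_apply] at h1
      linarith [inv_le_norm_meshPoint_far hδpos]
  simp only at hle
  rw [map_law_coincident _ _ rfl rfl, dirac_compl_eq_one hK.isClosed hnot] at hle
  exact absurd hle (by norm_num)

end Summit.CriticalPhenomena.SAWScalingLimit.Theorems.EventualTight.Negative

end
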